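import Mathlib
import HarnessLib
import Literature.MathematicalPhysics.QuantumLattice.GrassmannChargeScaling
import Literature.MathematicalPhysics.QuantumLattice.HubbardGridCounterQuadratic
import Literature.MathematicalPhysics.QuantumLattice.HubbardFermiLiquidBoundProofs
import Summits.HubbardSuperconductivity.HubbardSuperconductivity.Theorems.KLProgrammeKLRegimeTwoPointAssemblyConservation
import Summits.HubbardSuperconductivity.HubbardSuperconductivity.Theorems.KLProgrammeKLRegimeTwoPointAssemblyMatsubaraAllU
import Summits.HubbardSuperconductivity.HubbardSuperconductivity.Theorems.KLProgrammeKLRegimeVolumeLimitSchwingerDyson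

/-!
# Child `KLRegimeVolumeLimit` (stmt-HubbardSuperconductivity-19826 / its gen-4 twin) — the ORDER-`U` INSERTION of the finite-`M`
# Schwinger–Dyson form of the VL carrier IS the equal-time local occupation, and CONVERGES FOR EVERY COUPLING as `M → ∞`
# (seat hubbard-kl-k3c5-p3, technique «OS-positivity-free direct assembly»)

`…VolumeLimitSchwingerDyson` §6: in the bare frame and at every volume with `D(U) ≠ 0`,
`Σ̂⁰_{L,M}(k,σ) = U·(βL²)⁻²·Σ_q N(q,σ̄;U)/D + U²·βL²·b(k,σ)/D`.  Here the label-free first insertion is identified and its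
Matsubara limit taken, for EVERY real `U`:

* `§1` the interacting Gaussian expectation `a ↦ ∫dμ_C a` (bare Hubbard covariance, seed `0`) is INVARIANT under every non-zero
  scaling `ψ̂⁺_{kσ} ↦ φ(k,σ)ψ̂⁺_{kσ}`, `ψ̂⁻_{kσ} ↦ φ(k,σ)⁻¹ψ̂⁻_{kσ}` (`gaussExpect_map_scaling`; r2d-p2's weights and covariance
  invariance, `…TwoPointAssemblyConservation`, through `gaussConv_map_mulLeft`), and `e^{−V(U)}` is invariant under the
  vertex-compatible ones;
* `§2` SELECTION RULE for the interacting momentum-space two-point function at finite `M`, all `U`, with NO hypothesis on `D`: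
  `∫dμ_C ψ̂⁺_{p}ψ̂⁻_{q} e^{−V} = 0` unless `p = q` as (frequency, momentum, spin) labels (`gaussExpect_genPair_boltzmann_eq_zero_of_ne`);
* `§3` hence the OCCUPATION IDENTITY `∫dμ_C ψ⁺_{(x̄,0)τ}ψ⁻_{(x̄,0)τ} e^{−V} = (βL²)⁻² Σ_q N(q,τ;U)` at every torus site `x̄`
  (`gaussExpect_positionPair_boltzmann_eq_sum`): the order-`U` insertion is the equal-time, equal-point position-space two-point
  numerator of the tree's all-`U` Matsubara theorem;
* `§4` so by t2's `tendsto_grassmannTwoPoint_eq_hubbardThermalTwoPoint_sub_allU` (`L ≥ 3`, `β > 0`, EVERY `U`):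
  `(βL²)⁻² Σ_q N_M(q,τ;U)/D_M(U) ⟶ ⟨c†_{xτ}c_{xτ}⟩_{β,U,μ+U/2,L} − ½` as `M → ∞` (`tendsto_occupationRatio_allU`), a limit of modulus
  `≤ 3/2` uniformly in `L` (`norm_hubbardThermalTwoPoint_le_one`);
* `§5` CONSEQUENCE for clause (i) of the VL text: for every `U`, `L ≥ 3`, eventually in `M`, at every volume with `D_M(U) ≠ 0` and
  every label `(k, σ)`, `‖Σ̂⁰_{L,M}(k,σ) − U²·βL²·b_M(k,σ)/D_M‖ ≤ 2|U|` (`norm_klSelfEnergy_bare_sub_sixPoint_le_eventually`) — the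
  ORDER-`U` HALF of the uniform bound is discharged non-perturbatively and label-free; what remains of clause (i) is the six-point
  insertion `b(k,σ)` alone (TAU-BRIDGE.md §3, HOME/hubbard-kl-k3c5-p2).
Everything is proved; no definition.
-/

noncomputable section

namespace Summit.HubbardSuperconductivity.HubbardSuperconductivity.Theorems.TwoPointAssembly

set_option linter.dupNamespace false -- summit = problem name (single-conjunct summit), D-0017

open Finset Filter Topology Literature.MathematicalPhysics.QuantumLattice Literature.Probability.LatticeModels GrassmannAlgebra
open Summit.HubbardSuperconductivity.HubbardSuperconductivity.Theorems.KLRegimeSplit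
open Summit.HubbardSuperconductivity.HubbardSuperconductivity.Theorems.KLProgrammeLegKernels
open scoped ComplexConjugate

variable {L M : ℕ} [NeZero L]

/-! ## §1 Invariance of the interacting Gaussian expectation under vertex-compatible scalings -/

omit [NeZero L] in
/-- The bare Hubbard covariance (seed `0`) is entrywise invariant under every non-zero scaling weight. -/
theorem scaling_covariance_eq (φ : FreqMomentum L M × Fin 2 → ℂ) (hφ : ∀ p, φ p ≠ 0) (β μ : ℝ) :
    (Matrix.of fun X Y : HubbardFieldIdx L M => scalingWeight φ X * scalingWeight φ Y * hubbardCovariance L M β μ 0 X Y) =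
      hubbardCovariance L M β μ 0 := by
  ext X Y
  rw [Matrix.of_apply, ← hubbardCovarianceCT_zero_frame, scalingWeight_covariance_invariant φ hφ β μ 0 X Y]

/-- **The Gaussian expectation is invariant under every non-zero scaling** `ψ̂⁺ ↦ φψ̂⁺`, `ψ̂⁻ ↦ φ⁻¹ψ̂⁻`:
`∫dμ_C (S_φ a) = ∫dμ_C a` (the covariance pairs only reciprocal labels). -/
theorem gaussExpect_map_scaling (φ : FreqMomentum L M × Fin 2 → ℂ) (hφ : ∀ p, φ p ≠ 0) (β μ : ℝ) (a : HubbardGrassmann L M) :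
    gaussExpect ℂ (hubbardCovariance L M β μ 0) (ExteriorAlgebra.map (LinearMap.mulLeft ℂ (scalingWeight φ)) a) =
      gaussExpect ℂ (hubbardCovariance L M β μ 0) a := by
  rw [gaussExpect_apply, gaussConv_map_mulLeft, constPart_map, scaling_covariance_eq φ hφ, ← gaussExpect_apply]

/-- `e^{−V(U)}` is invariant under every vertex-compatible non-zero scaling. -/
theorem map_scaling_boltzmann (φ : FreqMomentum L M × Fin 2 → ℂ) (hφ : ∀ p, φ p ≠ 0)
    (hV : ∀ k₁ k₂ k₃ k₄ : FreqMomentum L M,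
      matsubaraInt M k₁.1 + matsubaraInt M k₃.1 = matsubaraInt M k₂.1 + matsubaraInt M k₄.1 ∧ k₁.2 + k₃.2 = k₂.2 + k₄.2 →
        φ (k₁, 0) * φ (k₃, 1) = φ (k₂, 0) * φ (k₄, 1))
    (β U : ℝ) :
    ExteriorAlgebra.map (LinearMap.mulLeft ℂ (scalingWeight φ)) (grassmannExp (-(hubbardInteraction L M β U))) =
      grassmannExp (-(hubbardInteraction L M β U)) := by
  rw [map_mulLeft_grassmannExp ℂ (scalingWeightInv_mul φ hφ), map_neg, map_scaling_hubbardInteraction φ hφ hV]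

/-! ## §2 The selection rule for the interacting momentum-space two-point function (all `U`, no hypothesis on `D`) -/

/-- Under a vertex-compatible scaling whose pair weight at `(X, Y)` is not `1`, `∫dμ_C ψ_X ψ_Y e^{−V} = 0`. -/
theorem gaussExpect_gen_mul_gen_boltzmann_eq_zero_of_weight_ne (φ : FreqMomentum L M × Fin 2 → ℂ) (hφ : ∀ p, φ p ≠ 0)
    (hV : ∀ k₁ k₂ k₃ k₄ : FreqMomentum L M,
      matsubaraInt M k₁.1 + matsubaraInt M k₃.1 = matsubaraInt M k₂.1 + matsubaraInt M k₄.1 ∧ k₁.2 + k₃.2 = k₂.2 + k₄.2 →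
        φ (k₁, 0) * φ (k₃, 1) = φ (k₂, 0) * φ (k₄, 1))
    (β U μ : ℝ) {X Y : HubbardFieldIdx L M} (hw : scalingWeight φ X * scalingWeight φ Y ≠ 1) :
    gaussExpect ℂ (hubbardCovariance L M β μ 0) (gen ℂ X * gen ℂ Y * grassmannExp (-(hubbardInteraction L M β U))) = 0 := by
  have h := gaussExpect_map_scaling φ hφ β μ (gen ℂ X * gen ℂ Y * grassmannExp (-(hubbardInteraction L M β U)))
  rw [_root_.map_mul (ExteriorAlgebra.map _), _root_.map_mul (ExteriorAlgebra.map _), map_scaling_boltzmann φ hφ hV, map_mulLeft_gen,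
    map_mulLeft_gen, smul_mul_smul_comm, smul_mul_assoc, map_smul, smul_eq_mul] at h
  -- `(w − 1) · E = 0` with `w ≠ 1`
  have h' : (scalingWeight φ X * scalingWeight φ Y - 1) *
      gaussExpect ℂ (hubbardCovariance L M β μ 0) (gen ℂ X * gen ℂ Y * grassmannExp (-(hubbardInteraction L M β U))) = 0 := by
    rw [sub_mul, one_mul, h, sub_self]
  exact (mul_eq_zero.mp h').resolve_left (sub_ne_zero.mpr hw)

/-- For two distinct labels there is a non-zero, vertex-compatible weight SEPARATING them (frequency `2^{n(ω)}`, momentum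
`χ(k⃗ᵢ)`, spin `2^{[σ=↑]}` — r2d-p2's three conservation weights). -/
theorem exists_separating_scaling {p q : FreqMomentum L M × Fin 2} (hpq : p ≠ q) :
    ∃ φ : FreqMomentum L M × Fin 2 → ℂ, (∀ r, φ r ≠ 0) ∧
      (∀ k₁ k₂ k₃ k₄ : FreqMomentum L M,
        matsubaraInt M k₁.1 + matsubaraInt M k₃.1 = matsubaraInt M k₂.1 + matsubaraInt M k₄.1 ∧ k₁.2 + k₃.2 = k₂.2 + k₄.2 →
          φ (k₁, 0) * φ (k₃, 1) = φ (k₂, 0) * φ (k₄, 1)) ∧ φ p ≠ φ q := by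
  obtain ⟨⟨ω, k⟩, σ⟩ := p
  obtain ⟨⟨ω', k'⟩, σ'⟩ := q
  by_cases hω : ω = ω'
  · subst hω
    by_cases hk : k = k'
    · subst hk
      have hσ : σ ≠ σ' := fun h => hpq (by rw [h])
      -- spin: weight `2^{[σ = ↑]}`
      refine ⟨fun r => if r.2 = 0 then 2 else 1, fun r => by dsimp only; split_ifs <;> norm_num, fun k₁ k₂ k₃ k₄ _ => by simp, ?_⟩
      fin_cases σ <;> fin_cases σ' <;> simp_all
    · -- momentum: some coordinate differs; weight `χ(k⃗ᵢ)`
      obtain ⟨i, hi⟩ : ∃ i, k i ≠ k' i := Function.ne_iff.mp hk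
      refine ⟨fun r => (ZMod.stdAddChar (r.1.2 i) : ℂ), fun r => stdAddChar_ne_zero (L := L) _, fun k₁ k₂ k₃ k₄ h => ?_, ?_⟩
      · rw [← AddChar.map_add_eq_mul, ← AddChar.map_add_eq_mul, ← Pi.add_apply k₁.2, ← Pi.add_apply k₂.2, h.2]
      · exact fun h => hi (ZMod.injective_stdAddChar h)
  · -- frequency: weight `2^{n(ω)}`
    refine ⟨fun r => (2 : ℂ) ^ (matsubaraInt M r.1.1), fun r => zpow_ne_zero _ two_ne_zero, fun k₁ k₂ k₃ k₄ h => ?_, ?_⟩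
    · rw [← zpow_add₀ two_ne_zero, ← zpow_add₀ two_ne_zero, h.1]
    · intro h
      dsimp only at h
      apply hω
      have h2 := two_zpow_injective h
      unfold matsubaraInt at h2
      exact Fin.ext (by omega)

/-- **SELECTION RULE (frequency, momentum, spin), all `U`, every finite `(L, M)`:** for label pairs `p ≠ q`,
`∫dμ_C ψ̂⁺_p ψ̂⁻_q e^{−V(U)} = 0` and `∫dμ_C ψ̂⁻_p ψ̂⁺_q e^{−V(U)} = 0`. -/
theorem gaussExpect_genPair_boltzmann_eq_zero_of_ne (β U μ : ℝ) {p q : FreqMomentum L M × Fin 2} (hpq : p ≠ q) :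
    gaussExpect ℂ (hubbardCovariance L M β μ 0)
        (gen ℂ ((p, 0) : HubbardFieldIdx L M) * gen ℂ ((q, 1) : HubbardFieldIdx L M) * grassmannExp (-(hubbardInteraction L M β U))) = 0 ∧
      gaussExpect ℂ (hubbardCovariance L M β μ 0)
        (gen ℂ ((p, 1) : HubbardFieldIdx L M) * gen ℂ ((q, 0) : HubbardFieldIdx L M) * grassmannExp (-(hubbardInteraction L M β U))) = 0 := by
  obtain ⟨φ, hφ, hV, hne⟩ := exists_separating_scaling (L := L) (M := M) hpq
  exact ⟨gaussExpect_gen_mul_gen_boltzmann_eq_zero_of_weight_ne φ hφ hV β U μ (scalingWeight_pair_ne_one' hφ hne),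
    gaussExpect_gen_mul_gen_boltzmann_eq_zero_of_weight_ne φ hφ hV β U μ (scalingWeight_pair_ne_one hφ hne)⟩

/-! ## §3 The occupation identity: the order-`U` insertion is the equal-time local two-point numerator -/

omit [NeZero L] in
/-- The two leg phases of `ψ⁺_{(x,t)}ψ⁻_{(x,t)}` at the SAME label cancel: `conj(e^{−ik·(x,t)}) · conj(e^{+ik·(x,t)}) = 1`. -/
theorem conj_vertexPlaneWave_zero_mul_one_self (β : ℝ) (k : FreqMomentum L M) (x : TorusSite 2 L) (t : ℝ) :
    conj (vertexPlaneWave L M β 0 k x t) * conj (vertexPlaneWave L M β 1 k x t) = 1 := by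
  rw [← map_mul, vertexPlaneWave, vertexPlaneWave, ← Complex.exp_add]
  have h : -((chargeSign 0 * vertexPhase L M β k x t : ℝ) : ℂ) * Complex.I +
      -((chargeSign 1 * vertexPhase L M β k x t : ℝ) : ℂ) * Complex.I = 0 := by
    simp only [chargeSign, Fin.isValue, ↓reduceIte, one_ne_zero, one_mul, neg_mul, one_mul, Complex.ofReal_neg]
    ring
  rw [h, Complex.exp_zero, map_one]

/-- **THE OCCUPATION IDENTITY** (all `U`, every finite `(L, M)`, every torus site `x̄`, spin `τ`):
`∫dμ_C ψ⁺_{(x̄,0)τ} ψ⁻_{(x̄,0)τ} e^{−V(U)} = (βL²)⁻² · Σ_q ∫dμ_C ψ̂⁺_{qτ}ψ̂⁻_{qτ} e^{−V(U)}` — the label sums of the two position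
fields collapse to the diagonal by the selection rule, and the diagonal phases cancel. -/
theorem gaussExpect_positionPair_boltzmann_eq_sum (β U μ : ℝ) (τ : Fin 2) (x : TorusSite 2 L) :
    gaussExpect ℂ (hubbardCovariance L M β μ 0)
        (positionField L M β 0 τ x 0 * positionField L M β 1 τ x 0 * grassmannExp (-(hubbardInteraction L M β U))) =
      (((1 / (β * (L : ℝ) ^ 2) ^ 2 : ℝ) : ℂ)) *
        ∑ q : FreqMomentum L M,
          gaussExpect ℂ (hubbardCovariance L M β μ 0)
            (gen ℂ (((q, τ), 0) : HubbardFieldIdx L M) * gen ℂ (((q, τ), 1) : HubbardFieldIdx L M) *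
              grassmannExp (-(hubbardInteraction L M β U))) := by
  rw [positionField_mul_positionField, Finset.sum_mul, map_sum]
  simp only [Finset.sum_mul, map_sum, smul_mul_assoc, map_smul, smul_eq_mul]
  rw [Finset.mul_sum]
  refine Finset.sum_congr rfl fun q _ => ?_
  rw [Finset.sum_eq_single q]
  · rw [mul_mul_mul_comm, conj_vertexPlaneWave_zero_mul_one_self, mul_one]
    push_cast
    ring
  · intro q' _ hq'
    rw [(gaussExpect_genPair_boltzmann_eq_zero_of_ne β U μ (p := (q, τ)) (q := (q', τ))
      (fun h => hq' (Prod.ext_iff.mp h).1.symm)).1, mul_zero]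
  · intro h; exact absurd (Finset.mem_univ _) h

/-- **The bare VL carrier as «local occupation + six-point insertion»** (`β ≠ 0`, `D(U) ≠ 0`, any torus site `x̄`):
`Σ̂⁰(k,σ) = U · ∫dμ_C ψ⁺_{(x̄,0)σ̄}ψ⁻_{(x̄,0)σ̄}e^{−V}/D + U² · βL² · b(k,σ)/D`. -/
theorem selfEnergy_fullActionCT_bare_eq_localOccupation_add {β : ℝ} (hβ : β ≠ 0) (U μ : ℝ) (k : FreqMomentum L M) (σ : Fin 2)
    (x : TorusSite 2 L) (hD : effPartitionFn ℂ (hubbardCovariance L M β μ 0) (hubbardInteraction L M β U) ≠ 0) :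
    selfEnergy L M β (fullActionCT L M β U μ 0) k σ =
      (U : ℂ) *
          gaussExpect ℂ (hubbardCovariance L M β μ 0)
            (positionField L M β 0 (1 - σ) x 0 * positionField L M β 1 (1 - σ) x 0 * grassmannExp (-(hubbardInteraction L M β U))) /
          effPartitionFn ℂ (hubbardCovariance L M β μ 0) (hubbardInteraction L M β U) +
        (U : ℂ) ^ 2 * ((β * (L : ℝ) ^ 2 : ℝ) : ℂ) *
          gaussExpect ℂ (hubbardCovariance L M β μ 0)
            (grassmannExp (-(hubbardInteraction L M β U)) *
              (grassmannDeriv ℂ (((k, σ), 0) : HubbardFieldIdx L M) (hubbardInteraction L M β 1) *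
                grassmannDeriv ℂ (((k, σ), 1) : HubbardFieldIdx L M) (hubbardInteraction L M β 1))) /
          effPartitionFn ℂ (hubbardCovariance L M β μ 0) (hubbardInteraction L M β U) := by
  rw [selfEnergy_fullActionCT_bare_eq_occupation_add hβ U μ k σ hD, gaussExpect_positionPair_boltzmann_eq_sum]
  ring

/-! ## §4 The Matsubara limit of the occupation ratio, for every coupling -/

/-- **The order-`U` insertion converges for EVERY `U`**: for `L ≥ 3`, `β > 0`, any `μ`, spin `τ` and lattice site `x`,
`(βL²)⁻² Σ_q N_M(q,τ;U)/D_M(U) ⟶ ⟨c†_{xτ}c_{xτ}⟩_{β,U,μ+U/2,L} − ½` as `M → ∞` (t2's all-`U` Matsubara theorem at equal points). -/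
theorem tendsto_occupationRatio_allU (hL : 3 ≤ L) {β : ℝ} (hβ : 0 < β) (μ U : ℝ) (τ : Fin 2) (x : Site 2) :
    Tendsto (fun M : ℕ =>
        (((1 / (β * (L : ℝ) ^ 2) ^ 2 : ℝ) : ℂ)) *
            (∑ q : FreqMomentum L M,
              gaussExpect ℂ (hubbardCovariance L M β μ 0)
                (gen ℂ (((q, τ), 0) : HubbardFieldIdx L M) * gen ℂ (((q, τ), 1) : HubbardFieldIdx L M) *
                  grassmannExp (-(hubbardInteraction L M β U)))) /
          effPartitionFn ℂ (hubbardCovariance L M β μ 0) (hubbardInteraction L M β U))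
      atTop (𝓝 (hubbardThermalTwoPoint β U (μ + U / 2) L x x τ τ - 1 / 2)) := by
  have h := MatsubaraAllU.tendsto_grassmannTwoPoint_eq_hubbardThermalTwoPoint_sub_allU hL hβ μ U τ τ x x
  rw [if_pos ⟨rfl, rfl⟩] at h
  refine h.congr fun M => ?_
  rw [gaussExpect_positionPair_boltzmann_eq_sum]

/-- The limit has modulus at most `3/2`, uniformly in the volume. -/
theorem norm_occupationLimit_le (β U μ : ℝ) (L : ℕ) (τ : Fin 2) (x : Site 2) :
    ‖hubbardThermalTwoPoint β U (μ + U / 2) L x x τ τ - 1 / 2‖ ≤ 3 / 2 := by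
  refine (norm_sub_le _ _).trans ?_
  have h := norm_hubbardThermalTwoPoint_le_one β U (μ + U / 2) L x x τ τ
  have h2 : ‖(1 / 2 : ℂ)‖ = 1 / 2 := by norm_num
  rw [h2]
  linarith

/-- **Eventually in `M`, the occupation ratio is bounded by `2`** (every `U`, `L ≥ 3`, `β > 0`). -/
theorem eventually_norm_occupationRatio_le_two (hL : 3 ≤ L) {β : ℝ} (hβ : 0 < β) (μ U : ℝ) (τ : Fin 2) :
    ∀ᶠ M : ℕ in atTop,
      ‖(((1 / (β * (L : ℝ) ^ 2) ^ 2 : ℝ) : ℂ)) *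
            (∑ q : FreqMomentum L M,
              gaussExpect ℂ (hubbardCovariance L M β μ 0)
                (gen ℂ (((q, τ), 0) : HubbardFieldIdx L M) * gen ℂ (((q, τ), 1) : HubbardFieldIdx L M) *
                  grassmannExp (-(hubbardInteraction L M β U)))) /
          effPartitionFn ℂ (hubbardCovariance L M β μ 0) (hubbardInteraction L M β U)‖ ≤ 2 := by
  have h := tendsto_occupationRatio_allU hL hβ μ U τ (0 : Site 2)
  have hlt : ‖hubbardThermalTwoPoint β U (μ + U / 2) L 0 0 τ τ - 1 / 2‖ < 2 :=
    (norm_occupationLimit_le β U μ L τ 0).trans_lt (by norm_num)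
  exact (h.norm.eventually (gt_mem_nhds hlt)).mono fun M hM => hM.le

/-! ## §5 Consequence: the order-`U` half of the uniform bound, label-free, for every coupling -/

/-- **THE ORDER-`U` HALF OF CLAUSE (i), DISCHARGED FOR EVERY `U`.**  For `L ≥ 3`, `β > 0`, any `U`, `μ`: eventually in `M`, at
every volume with `D_M(U) ≠ 0`, for EVERY label `(k, σ)`,
`‖klSelfEnergy L M β U μ 0 klE0 (nScales β + 1) k σ − U²·βL²·b_M(k,σ)/D_M‖ ≤ 2|U|`
— the bare VL carrier minus its six-point insertion is bounded uniformly in the label, the volume `L` and the cutoff. -/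
theorem norm_klSelfEnergy_bare_sub_sixPoint_le_eventually (hL : 3 ≤ L) {β : ℝ} (hβ : 0 < β) (U μ : ℝ) :
    ∀ᶠ M : ℕ in atTop, effPartitionFn ℂ (hubbardCovariance L M β μ 0) (hubbardInteraction L M β U) ≠ 0 →
      ∀ (k : FreqMomentum L M) (σ : Fin 2),
        ‖klSelfEnergy L M β U μ 0 klE0 (nScales β + 1) k σ -
            (U : ℂ) ^ 2 * ((β * (L : ℝ) ^ 2 : ℝ) : ℂ) *
              gaussExpect ℂ (hubbardCovariance L M β μ 0)
                (grassmannExp (-(hubbardInteraction L M β U)) *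
                  (grassmannDeriv ℂ (((k, σ), 0) : HubbardFieldIdx L M) (hubbardInteraction L M β 1) *
                    grassmannDeriv ℂ (((k, σ), 1) : HubbardFieldIdx L M) (hubbardInteraction L M β 1))) /
              effPartitionFn ℂ (hubbardCovariance L M β μ 0) (hubbardInteraction L M β U)‖ ≤ 2 * |U| := by
  filter_upwards [eventually_norm_occupationRatio_le_two hL hβ μ U 0, eventually_norm_occupationRatio_le_two hL hβ μ U 1]
    with M h0 h1 hD k σ
  rw [klSelfEnergy_nScales_succ_eq_selfEnergy_fullActionCT hβ, selfEnergy_fullActionCT_bare_eq_occupation_add hβ.ne' U μ k σ hD,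
    add_sub_cancel_right, mul_assoc, mul_div_assoc, norm_mul, Complex.norm_real, Real.norm_eq_abs, mul_comm]
  have hτ : ‖(((1 / (β * (L : ℝ) ^ 2) ^ 2 : ℝ) : ℂ)) *
        (∑ q : FreqMomentum L M,
          gaussExpect ℂ (hubbardCovariance L M β μ 0)
            (gen ℂ (((q, 1 - σ), 0) : HubbardFieldIdx L M) * gen ℂ (((q, 1 - σ), 1) : HubbardFieldIdx L M) *
              grassmannExp (-(hubbardInteraction L M β U)))) /
      effPartitionFn ℂ (hubbardCovariance L M β μ 0) (hubbardInteraction L M β U)‖ ≤ 2 := by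
    fin_cases σ
    · simpa using h1
    · simpa using h0
  exact mul_le_mul_of_nonneg_right hτ (abs_nonneg U)

end Summit.HubbardSuperconductivity.HubbardSuperconductivity.Theorems.TwoPointAssembly

end
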